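import Summits.FinalStateConjecture.FinalStateConjecture.Theses.PhaseMixingCapture
import Summits.FinalStateConjecture.FinalStateConjecture.Theses.GlobalAttraction
import
Summits.FinalStateConjecture.FinalStateConjecture.Theorems.PhaseMixingCaptureCaptureSufficesTameGlobalAttractionBridge
import HarnessLib

/-!
# `CaptureSufficesTame` (stmt-FinalStateConjecture-17270, route PhaseMixingCapture, rank 6),
# line `only-the-third-law-is-generic`, skeleton v4 (the label-rigid cut): the REDUCTION and its bridges

Skeleton v4 (`Cruxes/CaptureSufficesTame/Lines/only_the_third_law_is_generic.lean`, registered 2026-08-17,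
sha 1a84c5b9…) has four registered stubs: A = `stub_censoredExteriorsSettleC0` (VERBATIM item stmt-17296,
`GlobalAttraction.CensoredExteriorsSettle`), R = `stub_unparkingKick` (un-parking kicks along censored tame curves,
local ∃-form; the v2 stub, bridges landed: `unparkingKick_of_genericCensorshipThirdLaw`,
`unparkingKick_of_finalStateConjecture`), G = `stub_labelRigidityC0` (C⁰ LABEL RIGIDITY in the form the composition
consumes: two honest C⁰ final-state decompositions of one censored MGHD agree on "all holes are sub-extremal") and
U = `stub_intrinsicSubextremalUpgrade` (item stmt-17298 `GlobalAttraction.SubextremalUpgrade` with its label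
hypothesis made chart-independent). This file is the line's REDUCTION THEOREM (playbook: reduction first,
hypotheses = W + the four stub texts verbatim, `Theses`-free in shape) and the by-name BRIDGES that fix where G and
U sit relative to route GlobalAttraction — sorry-free, definition-free:

* `finalStateConjecture_of_labelRigidKick` — W → A → R → G → U → `FinalStateConjecture`: tame-generic censorship
  ⟹ tame-generic (censored ∧ un-parked) by the landed kick composition `isTameChristodoulouGeneric_of_relativeKick`
  fed with R ⟹ pointwise A gives an honest C⁰ configuration, un-parked gives one with sub-extremal holes, G makes
  EVERY honest C⁰ configuration sub-extremal, U upgrades to the summit's honest C² decomposition.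
* `captureSufficesTame_of_labelRigidKick` — the crux BY NAME from A (by name: `CensoredExteriorsSettle`), R, G, U
  (its first two hypotheses idle, the third = W).
* `intrinsicSubextremalUpgrade_of_subextremalUpgrade` — **U ⇐ item 17298** (instantiate `SubextremalUpgrade` at
  the configuration U is handed): the day 17298 lands, U is discharged by this one-liner.
* `subextremalUpgrade_of_labelRigidityC0` — **conversely G → U → item 17298**: under label rigidity the intrinsic
  upgrade IS GlobalAttraction's upgrade, so v4 splits 17298 as G ∧ U (U immune to the label question, G carrying it).
* `captureSufficesTame_of_globalAttraction_labelRigid` — the line's position in one formula: GlobalAttraction's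
  items 17296 + 17297 + 9937 together with G and U give the crux (17298 replaced by G ∧ U; R supplied by
  `unparkingKick_of_genericCensorshipThirdLaw`).

Nothing here is analysis or geometry: A, R, U carry the dynamics, G the C⁰ Lorentzian rigidity.
-/

set_option linter.dupNamespace false

noncomputable section

open scoped Manifold ContDiff Topology ENNReal
open Set Function Filter

namespace Summit.FinalStateConjecture.FinalStateConjecture.Theorems.PhaseMixingCaptureCaptureSufficesTame

open Literature.Geometry.Lorentzian
open Summit.FinalStateConjecture (HasCompleteNullInfinity exteriorOf RaysStayInClosure HasExhaustiveCharts
  IsFutureOriented)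
open Summit.FinalStateConjecture.FinalStateConjecture.Theses

/-- **v4 reduction: the re-typed summit from (W) tame weak cosmic censorship (VERBATIM the body of the crux's
hypothesis `WeakCosmicCensorshipTame`), (A) `stub_censoredExteriorsSettleC0`, (R) `stub_unparkingKick`,
(G) `stub_labelRigidityC0`, (U) `stub_intrinsicSubextremalUpgrade` — all four stub texts verbatim.** Tame-generic
censorship ⟹ tame-generic (censored ∧ un-parked) by the kick composition along censored curves fed with R ⟹ the
summit's matrix pointwise: A gives an honest C⁰ configuration, un-parked gives one with sub-extremal holes, G makes
every honest C⁰ configuration of the development sub-extremal, U upgrades to the honest C² sub-extremal decomposition.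
[folklore] -/
theorem finalStateConjecture_of_labelRigidKick :
    (∀ (X : Type) [TopologicalSpace X] [ChartedSpace E3 X] [IsManifold (𝓡 3) ∞ X] [T2Space X]
      [SecondCountableTopology X] [ConnectedSpace X],
      InitialDataSet.IsTameChristodoulouGeneric (admissibleVacuumData X)
        (fun D ↦ (∃ 𝒟 : VacuumCauchyDevelopment D, 𝒟.IsMaximal) ∧
          ∀ 𝒟 : VacuumCauchyDevelopment D, 𝒟.IsMaximal →
            HasCompleteNullInfinity 𝒟.toCauchyDevelopment) 1) →
    (∀ (X : Type) [TopologicalSpace X] [ChartedSpace E3 X] [IsManifold (𝓡 3) ∞ X] [T2Space X]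
      [SecondCountableTopology X] [ConnectedSpace X],
      ∀ D ∈ admissibleVacuumData X, ∀ 𝒟 : VacuumCauchyDevelopment D, 𝒟.IsMaximal →
        HasCompleteNullInfinity 𝒟.toCauchyDevelopment →
          ∃ (O : Set 𝒟.carrier) (d : FinalStateDecomposition 𝒟.toSpacetime O 0),
            O = exteriorOf 𝒟.toCauchyDevelopment d.charted ∧ RaysStayInClosure 𝒟.toCauchyDevelopment O ∧
              HasExhaustiveCharts d ∧ IsFutureOriented d) →
    (∀ (X : Type) [TopologicalSpace X] [ChartedSpace E3 X] [IsManifold (𝓡 3) ∞ X] [T2Space X]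
      [SecondCountableTopology X] [ConnectedSpace X],
      ∀ (e : AFEnd X) (F : EuclideanSpace ℝ (Fin 1) → InitialDataSet (𝓡 3) X),
        InitialDataSet.IsTameDataFamily e 1 F →
          ((InitialDataSet.IsImmersedAtZero 1 F ∧ Function.Injective F) ∨ ∀ c, F c = F 0) →
          (∀ c, F c ∈ admissibleVacuumData X) →
          (∀ c ≠ 0, (∃ 𝒟 : VacuumCauchyDevelopment (F c), 𝒟.IsMaximal) ∧
              ∀ 𝒟 : VacuumCauchyDevelopment (F c), 𝒟.IsMaximal →
                HasCompleteNullInfinity 𝒟.toCauchyDevelopment) →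
          ¬ (((∃ 𝒟 : VacuumCauchyDevelopment (F 0), 𝒟.IsMaximal) ∧
                    ∀ 𝒟 : VacuumCauchyDevelopment (F 0), 𝒟.IsMaximal →
                      HasCompleteNullInfinity 𝒟.toCauchyDevelopment) ∧
                  ∀ 𝒟 : VacuumCauchyDevelopment (F 0), 𝒟.IsMaximal →
                    HasCompleteNullInfinity 𝒟.toCauchyDevelopment ∧
                      ((∃ (O : Set 𝒟.carrier) (d₀ : FinalStateDecomposition 𝒟.toSpacetime O 0),
                          O = exteriorOf 𝒟.toCauchyDevelopment d₀.charted ∧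
                            RaysStayInClosure 𝒟.toCauchyDevelopment O ∧ HasExhaustiveCharts d₀ ∧
                              IsFutureOriented d₀) →
                        ∃ (O : Set 𝒟.carrier) (d : FinalStateDecomposition 𝒟.toSpacetime O 0),
                          (∀ i, Kerr.IsSubextremal (d.mass i) (d.spin i)) ∧
                            O = exteriorOf 𝒟.toCauchyDevelopment d.charted ∧
                              RaysStayInClosure 𝒟.toCauchyDevelopment O ∧ HasExhaustiveCharts d ∧
                                IsFutureOriented d)) →
          ∃ (e' : AFEnd X) (F' : EuclideanSpace ℝ (Fin 1) → InitialDataSet (𝓡 3) X),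
            InitialDataSet.IsTameDataFamily e' 1 F' ∧ F' 0 = F 0 ∧ Function.Injective F' ∧
              InitialDataSet.IsImmersedAtZero 1 F' ∧ (∀ c, F' c ∈ admissibleVacuumData X) ∧
              ∃ ε₀ > (0 : ℝ), ∀ c : EuclideanSpace ℝ (Fin 1), c ≠ 0 → ‖c‖ < ε₀ →
                (((∃ 𝒟 : VacuumCauchyDevelopment (F' c), 𝒟.IsMaximal) ∧
                    ∀ 𝒟 : VacuumCauchyDevelopment (F' c), 𝒟.IsMaximal →
                      HasCompleteNullInfinity 𝒟.toCauchyDevelopment) ∧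
                  ∀ 𝒟 : VacuumCauchyDevelopment (F' c), 𝒟.IsMaximal →
                    HasCompleteNullInfinity 𝒟.toCauchyDevelopment ∧
                      ((∃ (O : Set 𝒟.carrier) (d₀ : FinalStateDecomposition 𝒟.toSpacetime O 0),
                          O = exteriorOf 𝒟.toCauchyDevelopment d₀.charted ∧
                            RaysStayInClosure 𝒟.toCauchyDevelopment O ∧ HasExhaustiveCharts d₀ ∧
                              IsFutureOriented d₀) →
                        ∃ (O : Set 𝒟.carrier) (d : FinalStateDecomposition 𝒟.toSpacetime O 0),
                          (∀ i, Kerr.IsSubextremal (d.mass i) (d.spin i)) ∧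
                            O = exteriorOf 𝒟.toCauchyDevelopment d.charted ∧
                              RaysStayInClosure 𝒟.toCauchyDevelopment O ∧ HasExhaustiveCharts d ∧
                                IsFutureOriented d))) →
    (∀ (X : Type) [TopologicalSpace X] [ChartedSpace E3 X] [IsManifold (𝓡 3) ∞ X] [T2Space X]
      [SecondCountableTopology X] [ConnectedSpace X],
      ∀ D ∈ admissibleVacuumData X, ∀ 𝒟 : VacuumCauchyDevelopment D, 𝒟.IsMaximal →
        HasCompleteNullInfinity 𝒟.toCauchyDevelopment →
          ∀ (O₁ : Set 𝒟.carrier) (d₁ : FinalStateDecomposition 𝒟.toSpacetime O₁ 0)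
            (O₂ : Set 𝒟.carrier) (d₂ : FinalStateDecomposition 𝒟.toSpacetime O₂ 0),
            O₁ = exteriorOf 𝒟.toCauchyDevelopment d₁.charted → RaysStayInClosure 𝒟.toCauchyDevelopment O₁ →
              HasExhaustiveCharts d₁ → IsFutureOriented d₁ →
            O₂ = exteriorOf 𝒟.toCauchyDevelopment d₂.charted → RaysStayInClosure 𝒟.toCauchyDevelopment O₂ →
              HasExhaustiveCharts d₂ → IsFutureOriented d₂ →
            (∀ i, Kerr.IsSubextremal (d₁.mass i) (d₁.spin i)) →
              ∀ j, Kerr.IsSubextremal (d₂.mass j) (d₂.spin j)) →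
    (∀ (X : Type) [TopologicalSpace X] [ChartedSpace E3 X] [IsManifold (𝓡 3) ∞ X] [T2Space X]
      [SecondCountableTopology X] [ConnectedSpace X],
      ∀ D ∈ admissibleVacuumData X, ∀ 𝒟 : VacuumCauchyDevelopment D, 𝒟.IsMaximal →
        HasCompleteNullInfinity 𝒟.toCauchyDevelopment →
          (∃ (O : Set 𝒟.carrier) (d₀ : FinalStateDecomposition 𝒟.toSpacetime O 0),
              O = exteriorOf 𝒟.toCauchyDevelopment d₀.charted ∧ RaysStayInClosure 𝒟.toCauchyDevelopment O ∧
                HasExhaustiveCharts d₀ ∧ IsFutureOriented d₀) →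
          (∀ (O : Set 𝒟.carrier) (d₀ : FinalStateDecomposition 𝒟.toSpacetime O 0),
              O = exteriorOf 𝒟.toCauchyDevelopment d₀.charted → RaysStayInClosure 𝒟.toCauchyDevelopment O →
                HasExhaustiveCharts d₀ → IsFutureOriented d₀ →
                  ∀ i, Kerr.IsSubextremal (d₀.mass i) (d₀.spin i)) →
          ∃ (O' : Set 𝒟.carrier) (d : FinalStateDecomposition 𝒟.toSpacetime O' 2),
            (∀ i, Kerr.IsSubextremal (d.mass i) (d.spin i)) ∧
              O' = exteriorOf 𝒟.toCauchyDevelopment d.charted ∧ RaysStayInClosure 𝒟.toCauchyDevelopment O' ∧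
                HasExhaustiveCharts d ∧ IsFutureOriented d) →
    _root_.FinalStateConjecture := by
  intro hW hA hR hG hU X _ _ _ _ _ _
  have h𝓓 : ∀ d ∈ admissibleVacuumData X,
      ∃ e : AFEnd X, e.IsSoleEnd ∧ ∃ M : ℝ, e.IsStronglyAsymptoticallyFlatDR d M :=
    fun d hd ↦ exists_isSoleEnd_of_mem_admissibleVacuumData hd
  -- tame-generic (censored ∧ un-parked), by the kick composition along censored curves fed with R
  have gT : InitialDataSet.IsTameChristodoulouGeneric (admissibleVacuumData X)
      (fun D ↦ ((∃ 𝒟 : VacuumCauchyDevelopment D, 𝒟.IsMaximal) ∧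
          ∀ 𝒟 : VacuumCauchyDevelopment D, 𝒟.IsMaximal →
            HasCompleteNullInfinity 𝒟.toCauchyDevelopment) ∧
        ∀ 𝒟 : VacuumCauchyDevelopment D, 𝒟.IsMaximal →
          HasCompleteNullInfinity 𝒟.toCauchyDevelopment ∧
            ((∃ (O : Set 𝒟.carrier) (d₀ : FinalStateDecomposition 𝒟.toSpacetime O 0),
                O = exteriorOf 𝒟.toCauchyDevelopment d₀.charted ∧
                  RaysStayInClosure 𝒟.toCauchyDevelopment O ∧ HasExhaustiveCharts d₀ ∧
                    IsFutureOriented d₀) →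
              ∃ (O : Set 𝒟.carrier) (d : FinalStateDecomposition 𝒟.toSpacetime O 0),
                (∀ i, Kerr.IsSubextremal (d.mass i) (d.spin i)) ∧
                  O = exteriorOf 𝒟.toCauchyDevelopment d.charted ∧
                    RaysStayInClosure 𝒟.toCauchyDevelopment O ∧ HasExhaustiveCharts d ∧
                      IsFutureOriented d)) 1 :=
    isTameChristodoulouGeneric_of_relativeKick h𝓓 (hW X) (hR X)
  -- pointwise upgrade to the summit's matrix by A, un-parked, G and U
  refine gT.mono fun D hD hDT ↦ ⟨hDT.1.1, fun 𝒟 hmax ↦ ⟨hDT.1.2 𝒟 hmax, ?_⟩⟩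
  have hI : HasCompleteNullInfinity 𝒟.toCauchyDevelopment := hDT.1.2 𝒟 hmax
  -- A: an honest C⁰ configuration exists
  obtain ⟨O, d, hO, hRay, hExh, hFut⟩ := hA X D hD 𝒟 hmax hI
  -- un-parked: an honest C⁰ configuration with sub-extremal holes exists
  obtain ⟨O₁, d₁, hsub₁, hO₁, hRay₁, hExh₁, hFut₁⟩ := (hDT.2 𝒟 hmax).2 ⟨O, d, hO, hRay, hExh, hFut⟩
  -- G: hence every honest C⁰ configuration of `𝒟` has sub-extremal holes; U: the intrinsic upgrade
  exact hU X D hD 𝒟 hmax hI ⟨O, d, hO, hRay, hExh, hFut⟩ fun O₂ d₂ hO₂ hRay₂ hExh₂ hFut₂ ↦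
    hG X D hD 𝒟 hmax hI O₁ d₁ O₂ d₂ hO₁ hRay₁ hExh₁ hFut₁ hO₂ hRay₂ hExh₂ hFut₂ hsub₁

/-- **THE CRUX BY NAME along the v4 composition**: GlobalAttraction's item stmt-17296 (stub A, by name) and the
three stubs R, G, U give `PhaseMixingCapture.CaptureSufficesTame` — its first two hypotheses introduced and dropped
(idle under the tame re-typing), the third (`WeakCosmicCensorshipTame`) being the reduction's `hW`. [folklore] -/
theorem captureSufficesTame_of_labelRigidKick (hA : GlobalAttraction.CensoredExteriorsSettle)
    (hR : ∀ (X : Type) [TopologicalSpace X] [ChartedSpace E3 X] [IsManifold (𝓡 3) ∞ X] [T2Space X]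
      [SecondCountableTopology X] [ConnectedSpace X],
      ∀ (e : AFEnd X) (F : EuclideanSpace ℝ (Fin 1) → InitialDataSet (𝓡 3) X),
        InitialDataSet.IsTameDataFamily e 1 F →
          ((InitialDataSet.IsImmersedAtZero 1 F ∧ Function.Injective F) ∨ ∀ c, F c = F 0) →
          (∀ c, F c ∈ admissibleVacuumData X) →
          (∀ c ≠ 0, (∃ 𝒟 : VacuumCauchyDevelopment (F c), 𝒟.IsMaximal) ∧
              ∀ 𝒟 : VacuumCauchyDevelopment (F c), 𝒟.IsMaximal →
                HasCompleteNullInfinity 𝒟.toCauchyDevelopment) →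
          ¬ (((∃ 𝒟 : VacuumCauchyDevelopment (F 0), 𝒟.IsMaximal) ∧
                    ∀ 𝒟 : VacuumCauchyDevelopment (F 0), 𝒟.IsMaximal →
                      HasCompleteNullInfinity 𝒟.toCauchyDevelopment) ∧
                  ∀ 𝒟 : VacuumCauchyDevelopment (F 0), 𝒟.IsMaximal →
                    HasCompleteNullInfinity 𝒟.toCauchyDevelopment ∧
                      ((∃ (O : Set 𝒟.carrier) (d₀ : FinalStateDecomposition 𝒟.toSpacetime O 0),
                          O = exteriorOf 𝒟.toCauchyDevelopment d₀.charted ∧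
                            RaysStayInClosure 𝒟.toCauchyDevelopment O ∧ HasExhaustiveCharts d₀ ∧
                              IsFutureOriented d₀) →
                        ∃ (O : Set 𝒟.carrier) (d : FinalStateDecomposition 𝒟.toSpacetime O 0),
                          (∀ i, Kerr.IsSubextremal (d.mass i) (d.spin i)) ∧
                            O = exteriorOf 𝒟.toCauchyDevelopment d.charted ∧
                              RaysStayInClosure 𝒟.toCauchyDevelopment O ∧ HasExhaustiveCharts d ∧
                                IsFutureOriented d)) →
          ∃ (e' : AFEnd X) (F' : EuclideanSpace ℝ (Fin 1) → InitialDataSet (𝓡 3) X),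
            InitialDataSet.IsTameDataFamily e' 1 F' ∧ F' 0 = F 0 ∧ Function.Injective F' ∧
              InitialDataSet.IsImmersedAtZero 1 F' ∧ (∀ c, F' c ∈ admissibleVacuumData X) ∧
              ∃ ε₀ > (0 : ℝ), ∀ c : EuclideanSpace ℝ (Fin 1), c ≠ 0 → ‖c‖ < ε₀ →
                (((∃ 𝒟 : VacuumCauchyDevelopment (F' c), 𝒟.IsMaximal) ∧
                    ∀ 𝒟 : VacuumCauchyDevelopment (F' c), 𝒟.IsMaximal →
                      HasCompleteNullInfinity 𝒟.toCauchyDevelopment) ∧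
                  ∀ 𝒟 : VacuumCauchyDevelopment (F' c), 𝒟.IsMaximal →
                    HasCompleteNullInfinity 𝒟.toCauchyDevelopment ∧
                      ((∃ (O : Set 𝒟.carrier) (d₀ : FinalStateDecomposition 𝒟.toSpacetime O 0),
                          O = exteriorOf 𝒟.toCauchyDevelopment d₀.charted ∧
                            RaysStayInClosure 𝒟.toCauchyDevelopment O ∧ HasExhaustiveCharts d₀ ∧
                              IsFutureOriented d₀) →
                        ∃ (O : Set 𝒟.carrier) (d : FinalStateDecomposition 𝒟.toSpacetime O 0),
                          (∀ i, Kerr.IsSubextremal (d.mass i) (d.spin i)) ∧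
                            O = exteriorOf 𝒟.toCauchyDevelopment d.charted ∧
                              RaysStayInClosure 𝒟.toCauchyDevelopment O ∧ HasExhaustiveCharts d ∧
                                IsFutureOriented d)))
    (hG : ∀ (X : Type) [TopologicalSpace X] [ChartedSpace E3 X] [IsManifold (𝓡 3) ∞ X] [T2Space X]
      [SecondCountableTopology X] [ConnectedSpace X],
      ∀ D ∈ admissibleVacuumData X, ∀ 𝒟 : VacuumCauchyDevelopment D, 𝒟.IsMaximal →
        HasCompleteNullInfinity 𝒟.toCauchyDevelopment →
          ∀ (O₁ : Set 𝒟.carrier) (d₁ : FinalStateDecomposition 𝒟.toSpacetime O₁ 0)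
            (O₂ : Set 𝒟.carrier) (d₂ : FinalStateDecomposition 𝒟.toSpacetime O₂ 0),
            O₁ = exteriorOf 𝒟.toCauchyDevelopment d₁.charted → RaysStayInClosure 𝒟.toCauchyDevelopment O₁ →
              HasExhaustiveCharts d₁ → IsFutureOriented d₁ →
            O₂ = exteriorOf 𝒟.toCauchyDevelopment d₂.charted → RaysStayInClosure 𝒟.toCauchyDevelopment O₂ →
              HasExhaustiveCharts d₂ → IsFutureOriented d₂ →
            (∀ i, Kerr.IsSubextremal (d₁.mass i) (d₁.spin i)) →
              ∀ j, Kerr.IsSubextremal (d₂.mass j) (d₂.spin j))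
    (hU : ∀ (X : Type) [TopologicalSpace X] [ChartedSpace E3 X] [IsManifold (𝓡 3) ∞ X] [T2Space X]
      [SecondCountableTopology X] [ConnectedSpace X],
      ∀ D ∈ admissibleVacuumData X, ∀ 𝒟 : VacuumCauchyDevelopment D, 𝒟.IsMaximal →
        HasCompleteNullInfinity 𝒟.toCauchyDevelopment →
          (∃ (O : Set 𝒟.carrier) (d₀ : FinalStateDecomposition 𝒟.toSpacetime O 0),
              O = exteriorOf 𝒟.toCauchyDevelopment d₀.charted ∧ RaysStayInClosure 𝒟.toCauchyDevelopment O ∧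
                HasExhaustiveCharts d₀ ∧ IsFutureOriented d₀) →
          (∀ (O : Set 𝒟.carrier) (d₀ : FinalStateDecomposition 𝒟.toSpacetime O 0),
              O = exteriorOf 𝒟.toCauchyDevelopment d₀.charted → RaysStayInClosure 𝒟.toCauchyDevelopment O →
                HasExhaustiveCharts d₀ → IsFutureOriented d₀ →
                  ∀ i, Kerr.IsSubextremal (d₀.mass i) (d₀.spin i)) →
          ∃ (O' : Set 𝒟.carrier) (d : FinalStateDecomposition 𝒟.toSpacetime O' 2),
            (∀ i, Kerr.IsSubextremal (d.mass i) (d.spin i)) ∧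
              O' = exteriorOf 𝒟.toCauchyDevelopment d.charted ∧ RaysStayInClosure 𝒟.toCauchyDevelopment O' ∧
                HasExhaustiveCharts d ∧ IsFutureOriented d) :
    PhaseMixingCapture.CaptureSufficesTame :=
  fun _ _ hW ↦ finalStateConjecture_of_labelRigidKick hW hA hR hG hU

/-- **U ⇐ item stmt-17298.** GlobalAttraction's `SubextremalUpgrade` (an honest C⁰ configuration WITH
sub-extremal holes upgrades to the summit's honest C² decomposition) implies the chart-independent upgrade
`stub_intrinsicSubextremalUpgrade` of skeleton v4: instantiate it at the configuration U is handed, whose holes are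
sub-extremal by U's ∀-hypothesis. So U closes by name the day 17298 lands. [folklore] -/
theorem intrinsicSubextremalUpgrade_of_subextremalUpgrade (h : GlobalAttraction.SubextremalUpgrade) :
    ∀ (X : Type) [TopologicalSpace X] [ChartedSpace E3 X] [IsManifold (𝓡 3) ∞ X] [T2Space X]
      [SecondCountableTopology X] [ConnectedSpace X],
      ∀ D ∈ admissibleVacuumData X, ∀ 𝒟 : VacuumCauchyDevelopment D, 𝒟.IsMaximal →
        HasCompleteNullInfinity 𝒟.toCauchyDevelopment →
          (∃ (O : Set 𝒟.carrier) (d₀ : FinalStateDecomposition 𝒟.toSpacetime O 0),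
              O = exteriorOf 𝒟.toCauchyDevelopment d₀.charted ∧ RaysStayInClosure 𝒟.toCauchyDevelopment O ∧
                HasExhaustiveCharts d₀ ∧ IsFutureOriented d₀) →
          (∀ (O : Set 𝒟.carrier) (d₀ : FinalStateDecomposition 𝒟.toSpacetime O 0),
              O = exteriorOf 𝒟.toCauchyDevelopment d₀.charted → RaysStayInClosure 𝒟.toCauchyDevelopment O →
                HasExhaustiveCharts d₀ → IsFutureOriented d₀ →
                  ∀ i, Kerr.IsSubextremal (d₀.mass i) (d₀.spin i)) →
          ∃ (O' : Set 𝒟.carrier) (d : FinalStateDecomposition 𝒟.toSpacetime O' 2),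
            (∀ i, Kerr.IsSubextremal (d.mass i) (d.spin i)) ∧
              O' = exteriorOf 𝒟.toCauchyDevelopment d.charted ∧ RaysStayInClosure 𝒟.toCauchyDevelopment O' ∧
                HasExhaustiveCharts d ∧ IsFutureOriented d := by
  intro X _ _ _ _ _ _ D hD 𝒟 hmax hI hex hall
  obtain ⟨O, d₀, hO, hRay, hExh, hFut⟩ := hex
  exact h X D hD 𝒟 hmax hI O d₀ hO hRay hExh hFut (hall O d₀ hO hRay hExh hFut)

/-- **Conversely, under C⁰ label rigidity the intrinsic upgrade IS item stmt-17298**: G → U →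
`GlobalAttraction.SubextremalUpgrade`. Given an honest C⁰ configuration `(O, d₀)` with sub-extremal holes, G transfers
sub-extremality to every honest C⁰ configuration of the development, and U applies. Hence v4 splits 17298 as G ∧ U:
U is immune to the label question, G carries it. [folklore] -/
theorem subextremalUpgrade_of_labelRigidityC0 :
    (∀ (X : Type) [TopologicalSpace X] [ChartedSpace E3 X] [IsManifold (𝓡 3) ∞ X] [T2Space X]
      [SecondCountableTopology X] [ConnectedSpace X],
      ∀ D ∈ admissibleVacuumData X, ∀ 𝒟 : VacuumCauchyDevelopment D, 𝒟.IsMaximal →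
        HasCompleteNullInfinity 𝒟.toCauchyDevelopment →
          ∀ (O₁ : Set 𝒟.carrier) (d₁ : FinalStateDecomposition 𝒟.toSpacetime O₁ 0)
            (O₂ : Set 𝒟.carrier) (d₂ : FinalStateDecomposition 𝒟.toSpacetime O₂ 0),
            O₁ = exteriorOf 𝒟.toCauchyDevelopment d₁.charted → RaysStayInClosure 𝒟.toCauchyDevelopment O₁ →
              HasExhaustiveCharts d₁ → IsFutureOriented d₁ →
            O₂ = exteriorOf 𝒟.toCauchyDevelopment d₂.charted → RaysStayInClosure 𝒟.toCauchyDevelopment O₂ →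
              HasExhaustiveCharts d₂ → IsFutureOriented d₂ →
            (∀ i, Kerr.IsSubextremal (d₁.mass i) (d₁.spin i)) →
              ∀ j, Kerr.IsSubextremal (d₂.mass j) (d₂.spin j)) →
    (∀ (X : Type) [TopologicalSpace X] [ChartedSpace E3 X] [IsManifold (𝓡 3) ∞ X] [T2Space X]
      [SecondCountableTopology X] [ConnectedSpace X],
      ∀ D ∈ admissibleVacuumData X, ∀ 𝒟 : VacuumCauchyDevelopment D, 𝒟.IsMaximal →
        HasCompleteNullInfinity 𝒟.toCauchyDevelopment →
          (∃ (O : Set 𝒟.carrier) (d₀ : FinalStateDecomposition 𝒟.toSpacetime O 0),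
              O = exteriorOf 𝒟.toCauchyDevelopment d₀.charted ∧ RaysStayInClosure 𝒟.toCauchyDevelopment O ∧
                HasExhaustiveCharts d₀ ∧ IsFutureOriented d₀) →
          (∀ (O : Set 𝒟.carrier) (d₀ : FinalStateDecomposition 𝒟.toSpacetime O 0),
              O = exteriorOf 𝒟.toCauchyDevelopment d₀.charted → RaysStayInClosure 𝒟.toCauchyDevelopment O →
                HasExhaustiveCharts d₀ → IsFutureOriented d₀ →
                  ∀ i, Kerr.IsSubextremal (d₀.mass i) (d₀.spin i)) →
          ∃ (O' : Set 𝒟.carrier) (d : FinalStateDecomposition 𝒟.toSpacetime O' 2),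
            (∀ i, Kerr.IsSubextremal (d.mass i) (d.spin i)) ∧
              O' = exteriorOf 𝒟.toCauchyDevelopment d.charted ∧ RaysStayInClosure 𝒟.toCauchyDevelopment O' ∧
                HasExhaustiveCharts d ∧ IsFutureOriented d) →
    GlobalAttraction.SubextremalUpgrade := by
  intro hG hU X _ _ _ _ _ _ D hD 𝒟 hmax hI O d₀ hO hRay hExh hFut hsub
  exact hU X D hD 𝒟 hmax hI ⟨O, d₀, hO, hRay, hExh, hFut⟩ fun O₂ d₂ hO₂ hRay₂ hExh₂ hFut₂ ↦
    hG X D hD 𝒟 hmax hI O d₀ O₂ d₂ hO hRay hExh hFut hO₂ hRay₂ hExh₂ hFut₂ hsub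

/-- **The line's position in one formula.** GlobalAttraction's items stmt-17296 (`CensoredExteriorsSettle`),
stmt-17297 (`GenericCensorshipThirdLaw`) and stmt-9937 (`MGHDExists`), together with the two v4 stubs G and U, give
the crux: R is supplied by `unparkingKick_of_genericCensorshipThirdLaw` (17297 + 9937), and 17298 is replaced by
G ∧ U. Compare `captureSufficesTame_of_globalAttraction` (17296 + 17297 + 17298 + 9937). [folklore] -/
theorem captureSufficesTame_of_globalAttraction_labelRigid (h₁ : GlobalAttraction.CensoredExteriorsSettle)
    (h₂ : GlobalAttraction.GenericCensorshipThirdLaw)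
    (hG : ∀ (X : Type) [TopologicalSpace X] [ChartedSpace E3 X] [IsManifold (𝓡 3) ∞ X] [T2Space X]
      [SecondCountableTopology X] [ConnectedSpace X],
      ∀ D ∈ admissibleVacuumData X, ∀ 𝒟 : VacuumCauchyDevelopment D, 𝒟.IsMaximal →
        HasCompleteNullInfinity 𝒟.toCauchyDevelopment →
          ∀ (O₁ : Set 𝒟.carrier) (d₁ : FinalStateDecomposition 𝒟.toSpacetime O₁ 0)
            (O₂ : Set 𝒟.carrier) (d₂ : FinalStateDecomposition 𝒟.toSpacetime O₂ 0),
            O₁ = exteriorOf 𝒟.toCauchyDevelopment d₁.charted → RaysStayInClosure 𝒟.toCauchyDevelopment O₁ →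
              HasExhaustiveCharts d₁ → IsFutureOriented d₁ →
            O₂ = exteriorOf 𝒟.toCauchyDevelopment d₂.charted → RaysStayInClosure 𝒟.toCauchyDevelopment O₂ →
              HasExhaustiveCharts d₂ → IsFutureOriented d₂ →
            (∀ i, Kerr.IsSubextremal (d₁.mass i) (d₁.spin i)) →
              ∀ j, Kerr.IsSubextremal (d₂.mass j) (d₂.spin j))
    (hU : ∀ (X : Type) [TopologicalSpace X] [ChartedSpace E3 X] [IsManifold (𝓡 3) ∞ X] [T2Space X]
      [SecondCountableTopology X] [ConnectedSpace X],
      ∀ D ∈ admissibleVacuumData X, ∀ 𝒟 : VacuumCauchyDevelopment D, 𝒟.IsMaximal →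
        HasCompleteNullInfinity 𝒟.toCauchyDevelopment →
          (∃ (O : Set 𝒟.carrier) (d₀ : FinalStateDecomposition 𝒟.toSpacetime O 0),
              O = exteriorOf 𝒟.toCauchyDevelopment d₀.charted ∧ RaysStayInClosure 𝒟.toCauchyDevelopment O ∧
                HasExhaustiveCharts d₀ ∧ IsFutureOriented d₀) →
          (∀ (O : Set 𝒟.carrier) (d₀ : FinalStateDecomposition 𝒟.toSpacetime O 0),
              O = exteriorOf 𝒟.toCauchyDevelopment d₀.charted → RaysStayInClosure 𝒟.toCauchyDevelopment O →
                HasExhaustiveCharts d₀ → IsFutureOriented d₀ →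
                  ∀ i, Kerr.IsSubextremal (d₀.mass i) (d₀.spin i)) →
          ∃ (O' : Set 𝒟.carrier) (d : FinalStateDecomposition 𝒟.toSpacetime O' 2),
            (∀ i, Kerr.IsSubextremal (d.mass i) (d.spin i)) ∧
              O' = exteriorOf 𝒟.toCauchyDevelopment d.charted ∧ RaysStayInClosure 𝒟.toCauchyDevelopment O' ∧
                HasExhaustiveCharts d ∧ IsFutureOriented d)
    (h₄ : GlobalAttraction.MGHDExists) : PhaseMixingCapture.CaptureSufficesTame :=
  captureSufficesTame_of_labelRigidKick h₁ (unparkingKick_of_genericCensorshipThirdLaw h₂ h₄) hG hU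

/-- Sanity composition: the two bridges compose to GlobalAttraction's path — with G granted, GlobalAttraction's
four items give the crux along the v4 composition as well. -/
example (h₁ : GlobalAttraction.CensoredExteriorsSettle) (h₂ : GlobalAttraction.GenericCensorshipThirdLaw)
    (h₃ : GlobalAttraction.SubextremalUpgrade) (h₄ : GlobalAttraction.MGHDExists)
    (hG : ∀ (X : Type) [TopologicalSpace X] [ChartedSpace E3 X] [IsManifold (𝓡 3) ∞ X] [T2Space X]
      [SecondCountableTopology X] [ConnectedSpace X],
      ∀ D ∈ admissibleVacuumData X, ∀ 𝒟 : VacuumCauchyDevelopment D, 𝒟.IsMaximal →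
        HasCompleteNullInfinity 𝒟.toCauchyDevelopment →
          ∀ (O₁ : Set 𝒟.carrier) (d₁ : FinalStateDecomposition 𝒟.toSpacetime O₁ 0)
            (O₂ : Set 𝒟.carrier) (d₂ : FinalStateDecomposition 𝒟.toSpacetime O₂ 0),
            O₁ = exteriorOf 𝒟.toCauchyDevelopment d₁.charted → RaysStayInClosure 𝒟.toCauchyDevelopment O₁ →
              HasExhaustiveCharts d₁ → IsFutureOriented d₁ →
            O₂ = exteriorOf 𝒟.toCauchyDevelopment d₂.charted → RaysStayInClosure 𝒟.toCauchyDevelopment O₂ →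
              HasExhaustiveCharts d₂ → IsFutureOriented d₂ →
            (∀ i, Kerr.IsSubextremal (d₁.mass i) (d₁.spin i)) →
              ∀ j, Kerr.IsSubextremal (d₂.mass j) (d₂.spin j)) :
    PhaseMixingCapture.CaptureSufficesTame :=
  captureSufficesTame_of_globalAttraction_labelRigid h₁ h₂ hG (intrinsicSubextremalUpgrade_of_subextremalUpgrade h₃)
    h₄

end Summit.FinalStateConjecture.FinalStateConjecture.Theorems.PhaseMixingCaptureCaptureSufficesTame

end
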